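import Mathlib
import Summits.Langlands.Langlands.Theorems.PicardMuOrdinaryResidualAutomorphyOddProjective
import Summits.Langlands.Langlands.Theorems.PicardMuOrdinaryResidualAutomorphyOddTable
import Summits.Langlands.Langlands.Theorems.PicardMuOrdinaryResidualAutomorphyOddDedekind
import Summits.Langlands.Langlands.Theorems.PicardMuOrdinaryResidualAutomorphyOddOmega
import Literature.NumberTheory.Automorphic.LanglandsTetrahedral
import Literature.NumberTheory.GaloisRepresentations.ChebotarevFromCyclic
import Literature.NumberTheory.GaloisRepresentations.ChebotarevCyclicProofs
import Literature.NumberTheory.GaloisRepresentations.ChebotarevCyclotomicProofs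
import Literature.NumberTheory.Automorphic.HilbertModularGaloisRepProofs
import Literature.NumberTheory.Automorphic.Sweep1SymmetricPowerAdelic
import HarnessLib

/-!
# The Galois side of `ResidualAutomorphyOdd` (helper for item stmt-Langlands-13759, route PicardMuOrdinary)

Conditional on Tate's lifting theorem (`Tate_projectiveLifting`, tree fact), for an integer quartic
`f` with separable image in `ℚ[X]`, `12 ∣ #Gal(f)` and not all roots real: a lift `σ̄ : Γ_ℚ → GL₂(𝔽̄₃)`
of `Γ_ℚ → Gal(f) ⊆ S₄ ≅ PGL₂(𝔽₃)` is IRREDUCIBLE (the image contains the Klein group, whose lifts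
anticommute: `isIrreducible_of_lift`), satisfies the NON-DIHEDRAL clause (`nonDihedral_of_lift`:
Chebotarev for `σ̄ ⊕ χ_{K'}` at an element outside `Γ_{K'}` of non-zero trace), and its Frobenius
traces/determinants produce the route's table of reduced Hecke polynomials through Dedekind's recipe
(`galoisSide`, with the sign recipe `signOf` and its Hecke character from `…Omega`).
-/

set_option linter.dupNamespace false -- project-wide option (lakefile weak.linter.dupNamespace); `Summit.Langlands.Langlands` is the mandated namespace

noncomputable section

open scoped MatrixGroups Polynomial NumberField
open Polynomial

namespace Summit.Langlands.Langlands.Theorems.ResidualAutomorphyOdd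

section Lift

open scoped MatrixGroups Classical
open NumberField Field IsDedekindDomain Literature.NumberTheory.GaloisRepresentations Matrix

variable {f : ℤ[X]} {hdeg : f.natDegree = 4} {hsep : (fQ f).Separable}
variable {σ : FramedGaloisRep ℚ K3 2} (hσ : IsProjectiveLift (rhoTilde hdeg hsep) σ)

/-! ### Irreducibility -/

include hσ in
/-- **Irreducibility.** A lift `σ` of `ρ̃` is irreducible when `12 ∣ #Gal(f)`: the image then
contains the Klein group, whose lifts `(0 -1; 1 0)`, `(1 1; 1 -1)` anticommute and have no common
eigenvector in characteristic `3`. -/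
theorem isIrreducible_of_lift (hgal : 12 ∣ Nat.card (fQ f).Gal) : σ.toGaloisRep.IsIrreducible := by
  classical
  by_contra hirr
  -- a common eigenvector
  have h2 : Module.finrank K3 (Fin 2 → K3) = 2 := Module.finrank_fin_fun K3
  obtain ⟨W, hW⟩ := exists_subrepresentation_finrank_eq_one_of_not_isIrreducible_two
    (FramedRep.toRepresentation σ) h2 hirr
  obtain ⟨v, hv0, hv⟩ := exists_stableLine_of_finrank_eq_one _ hW
  -- lifts of the two double transpositions
  have hsq := fun τ => mul_self_mem_of_twelve_dvd _ (twelve_dvd_card_range hdeg hsep hgal) τ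
  obtain ⟨ρA, hρA⟩ : ∃ ρ : Equiv.Perm (Fin 4), ρ * ρ = Equiv.swap 0 1 * Equiv.swap 2 3 := by decide
  obtain ⟨ρB, hρB⟩ : ∃ ρ : Equiv.Perm (Fin 4), ρ * ρ = Equiv.swap 0 2 * Equiv.swap 1 3 := by decide
  obtain ⟨γA, hγA⟩ := hsq ρA
  obtain ⟨γB, hγB⟩ := hsq ρB
  obtain ⟨gA, cA, hcA, hpermA, hA⟩ := exists_lift_entries hσ γA
  obtain ⟨gB, cB, hcB, hpermB, hB⟩ := exists_lift_entries hσ γB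
  have heA := entries_of_actFin_eq_dA (gA 0 0) (gA 0 1) (gA 1 0) (gA 1 1) (det_entries gA)
    (fun i => by rw [← permHom_apply, hpermA, hγA, hρA])
  have heB := entries_of_actFin_eq_dB (gB 0 0) (gB 0 1) (gB 1 0) (gB 1 1) (det_entries gB)
    (fun i => by rw [← permHom_apply, hpermB, hγB, hρB])
  obtain ⟨hA00, hA11, hA10⟩ := heA
  obtain ⟨hB01, hB10, hB11⟩ := heB
  -- anticommutation
  set P := ((σ γA : GL (Fin 2) K3) : Matrix (Fin 2) (Fin 2) K3) with hP
  set Q := ((σ γB : GL (Fin 2) K3) : Matrix (Fin 2) (Fin 2) K3) with hQ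
  have hanti : P * Q = -(Q * P) := by
    rw [hA, hB, Matrix.smul_mul, Matrix.mul_smul, Matrix.smul_mul, Matrix.mul_smul, smul_smul, smul_smul,
      mul_comm cB cA, ← smul_neg]
    congr 1
    ext i j
    fin_cases i <;> fin_cases j <;>
      simp [Matrix.mul_apply, Fin.sum_univ_two, Matrix.map_apply, hA00, hA11, hA10, hB01, hB10, hB11] <;> ring
  -- eigenvalues
  obtain ⟨lA, hlA⟩ := hv γA
  obtain ⟨lB, hlB⟩ := hv γB
  rw [FramedRep.toRepresentation_apply_apply] at hlA hlB
  have h1 : (P * Q) *ᵥ v = (lB * lA) • v := by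
    rw [← Matrix.mulVec_mulVec, hlB, Matrix.mulVec_smul, hlA, smul_smul]
  have h2' : (Q * P) *ᵥ v = (lA * lB) • v := by
    rw [← Matrix.mulVec_mulVec, hlA, Matrix.mulVec_smul, hlB, smul_smul]
  rw [hanti, Matrix.neg_mulVec, h2'] at h1
  have h3 : (2 * lA * lB) • v = 0 := by
    have : (lB * lA) • v + (lA * lB) • v = 0 := by rw [← h1]; exact neg_add_cancel _
    rw [← add_smul] at this
    convert this using 2; ring
  rw [smul_eq_zero] at h3
  rcases h3 with h3 | h3
  · rcases mul_eq_zero.1 h3 with h4 | h4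
    · rcases mul_eq_zero.1 h4 with h5 | h5
      · exact two_ne_zero_K3 h5
      · apply hv0
        rw [h5, zero_smul] at hlA
        exact Matrix.eq_zero_of_mulVec_eq_zero (Matrix.GeneralLinearGroup.det_ne_zero _) hlA
    · apply hv0
      rw [h4, zero_smul] at hlB
      exact Matrix.eq_zero_of_mulVec_eq_zero (Matrix.GeneralLinearGroup.det_ne_zero _) hlB
  · exact hv0 h3

/-! ### The non-dihedral clause: inert places with non-zero trace -/

include hσ in
/-- `tr σ(γ) ≠ 0` when `permFin γ` is trace-good. -/
theorem trace_ne_zero_of_trOK {γ : absoluteGaloisGroup ℚ}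
    (h : fixCard (permFin hdeg hsep γ) = 4 ∨ fixCard (permFin hdeg hsep γ) = 1 ∨
      (fixCard (permFin hdeg hsep γ) = 0 ∧ fixCard (permFin hdeg hsep γ ^ 2) = 0)) :
    Matrix.trace ((σ γ : GL (Fin 2) K3) : Matrix (Fin 2) (Fin 2) K3) ≠ 0 := by
  obtain ⟨g, c, hc, hperm, hshape⟩ := exists_lift_entries hσ γ
  rw [(trace_det_of_lift hshape).1]
  refine mul_ne_zero hc ?_
  rw [map_ne_zero_iff _ (castF3).injective]
  rw [← hperm, fixCard_permHom, fixCard_permHom_sq] at h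
  exact (trace_ne_zero_iff_entries _ _ _ _ (det_entries g)).2 h

open Literature.NumberTheory.Automorphic in
include hσ in
/-- **The non-dihedral clause.** For every quadratic field `K'` there are infinitely many places `v`,
inert in `K'`, at which `σ` is unramified with a Frobenius of non-zero trace (Chebotarev for
`σ ⊕ χ_{K'}` applied to an element `g ∉ Γ_{K'}` with `tr σ(g) ≠ 0`, which exists because the image
of `Γ_ℚ` in `S₄` contains `A₄`). -/
theorem nonDihedral_of_lift (hgal : 12 ∣ Nat.card (fQ f).Gal) (K' : Type) [Field K'] [NumberField K']
    [Algebra ℚ K'] (hK' : Module.finrank ℚ K' = 2) :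
    {v : HeightOneSpectrum (𝓞 ℚ) | quadraticSign K' v = -1 ∧ σ.IsUnramifiedAt v ∧
      ∃ 𝔓 ∈ v.primesAbove, ∃ Φ : absoluteGaloisGroup ℚ, IsArithFrobAt (𝓞 ℚ) Φ 𝔓 ∧
        Matrix.trace ((σ Φ : GL (Fin 2) K3) : Matrix (Fin 2) (Fin 2) K3) ≠ 0}.Infinite := by
  classical
  haveI : FiniteDimensional ℚ K' := Module.finite_of_finrank_eq_succ hK'
  obtain ⟨hopen, hidx⟩ := isOpen_range_absGaloisRestrict_and_index ℚ K'
  rw [hK'] at hidx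
  set H : Subgroup (absoluteGaloisGroup ℚ) := (absGaloisRestrict ℚ K').range with hHdef
  -- an element outside `H` with non-zero trace
  have hsq := fun τ => mul_self_mem_of_twelve_dvd _ (twelve_dvd_card_range hdeg hsep hgal) τ
  obtain ⟨g₀, hg₀⟩ : ∃ g₀ : absoluteGaloisGroup ℚ, g₀ ∉ H := by
    by_contra hall
    push Not at hall
    have htop : H = ⊤ := by ext x; exact ⟨fun _ => trivial, fun _ => hall x⟩
    rw [← Subgroup.index_eq_one, hidx] at htop
    exact absurd htop (by norm_num)
  obtain ⟨g, hgH, hgtr⟩ : ∃ g : absoluteGaloisGroup ℚ, g ∉ H ∧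
      Matrix.trace ((σ g : GL (Fin 2) K3) : Matrix (Fin 2) (Fin 2) K3) ≠ 0 := by
    rcases trOK_or_exists_threeCycle (permFin hdeg hsep g₀) with hok | ⟨ζ, hζ, hok⟩
    · exact ⟨g₀, hg₀, trace_ne_zero_of_trOK hσ hok⟩
    · obtain ⟨γ, hγ⟩ := hsq (ζ * ζ)
      rw [threeCycle_eq_sq_sq ζ hζ] at hγ
      by_cases hγH : γ ∈ H
      · refine ⟨g₀ * γ, fun h => hg₀ ?_, trace_ne_zero_of_trOK hσ (by rwa [map_mul, hγ])⟩
        have := H.mul_mem h (H.inv_mem hγH)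
        rwa [mul_inv_cancel_right] at this
      · exact ⟨γ, hγH, trace_ne_zero_of_trOK hσ (by rw [hγ]; exact Or.inr (Or.inl hζ))⟩
  -- the representation `σ ⊕ χ`
  set χ := signCharOfIndexTwo (R := K3) H hidx with hχ
  have hkerσ : IsOpen (σ.toMonoidHom.ker : Set (absoluteGaloisGroup ℚ)) := by
    have h1 : (σ.toMonoidHom.ker : Set (absoluteGaloisGroup ℚ)) = σ ⁻¹' {1} := by
      ext x; simp [MonoidHom.mem_ker]
    rw [h1]
    exact (isOpen_discrete _).preimage (map_continuous σ)
  have hker : IsOpen ((blockSum σ.toMonoidHom χ).ker : Set (absoluteGaloisGroup ℚ)) := by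
    rw [ker_blockSum, hχ, ker_signCharOfIndexTwo]
    exact hkerσ.inter hopen
  let τ : FramedGaloisRep ℚ K3 3 :=
    { blockSum σ.toMonoidHom χ with continuous_toFun := MonoidHom.continuous_of_isOpen_ker _ hker }
  have hτ : ∀ x, τ x = blockSum σ.toMonoidHom χ x := fun _ => rfl
  have hkerτ : IsOpen (τ.toMonoidHom.ker : Set (absoluteGaloisGroup ℚ)) := hker
  have hinf := FramedGaloisRep.infinite_setOf_frobenius_eq_of_cyclic
    (fun M L _ _ _ _ _ _ g' hg' => infinite_setOf_frobenius_eq_of_isCyclic chebotarev_cyclotomicExtension_holds g' hg')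
    τ hkerτ g
  refine hinf.mono ?_
  rintro v ⟨hunr, 𝔓, h𝔓, Φ, hΦ, hval⟩
  rw [hτ, hτ, blockSum_apply_eq_iff] at hval
  have hunr' : ∀ 𝔓 ∈ v.primesAbove, ∀ γ ∈ 𝔓.inertia (absoluteGaloisGroup ℚ), σ γ = 1 ∧ χ γ = 1 := by
    intro 𝔓 h𝔓 γ hγ
    have h := hunr 𝔓 h𝔓 γ hγ
    rw [hτ, ← (blockSum σ.toMonoidHom χ).map_one, blockSum_apply_eq_iff, map_one, map_one] at h
    exact h
  have hmemH : ∀ γ, χ γ = 1 → γ ∈ H := by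
    intro γ h
    rw [← ker_signCharOfIndexTwo (R := K3) H hidx, MonoidHom.mem_ker]
    exact h
  refine ⟨?_, fun 𝔓 h𝔓 γ hγ => (hunr' 𝔓 h𝔓 γ hγ).1, 𝔓, h𝔓, Φ, hΦ, ?_⟩
  · refine quadraticSign_eq_neg_one_of_signChar K' hidx (fun 𝔓 h𝔓 γ hγ => ?_) h𝔓 hΦ ?_
    · exact signCharOfIndexTwo_apply_of_mem hidx (hmemH γ (hunr' 𝔓 h𝔓 γ hγ).2)
    · apply signCharOfIndexTwo_apply_of_not_mem hidx
      intro hΦH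
      have h1 : χ Φ = 1 := signCharOfIndexTwo_apply_of_mem hidx hΦH
      rw [hval.2, hχ, signCharOfIndexTwo_apply_of_not_mem hidx hgH] at h1
      exact neg_one_ne_one_K3 h1
  · have h1 : (σ Φ : GL (Fin 2) K3) = σ g := hval.1
    rw [h1]
    exact hgtr

/-! ### Assembly of the Galois side -/

section Assembly

open scoped Classical
open Literature.NumberTheory.Automorphic

/-- The residue field at `placeOf p` has `p` elements. -/
theorem residueCard_placeOf (p : ℕ) (hp : p.Prime) : (placeOf p hp).residueCard = p := by
  rw [residueCard_eq_primesEquiv, primesEquiv_placeOf]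

/-- `p ∈ placeOf p`. -/
theorem natCast_mem_placeOf (p : ℕ) (hp : p.Prime) : (p : 𝓞 ℚ) ∈ (placeOf p hp).asIdeal := by
  have h := Ideal.absNorm_mem (placeOf p hp).asIdeal
  rwa [← HeightOneSpectrum.residueCard, residueCard_placeOf] at h

/-- The sign recipe: `s(p) = +1` iff `disc(f)` is a square modulo `p`. -/
def signOf (f : ℤ[X]) (p : ℕ) : ℤˣ :=
  if ∃ y : ZMod p, y ^ 2 = (f.map (Int.castRingHom (ZMod p))).discr then 1 else -1

/-- The table polynomial in terms of the Frobenius permutation. -/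
theorem tablePoly_eq_cycleTable (F : Type) [CommRing F] [IsDomain F] (f : ℤ[X]) (π : Equiv.Perm (Fin 4))
    (hcount : (f.map (Int.castRingHom F)).roots.toFinset.card = fixCard π)
    (hdisc : (∃ w : F, w ^ 2 = (f.map (Int.castRingHom F)).discr) ↔ Equiv.Perm.sign π = 1) :
    tablePoly F f = cycleTable (fixCard π) (decide (Equiv.Perm.sign π = 1)) := by
  unfold tablePoly cycleTable
  simp only [hcount, hdisc, decide_eq_true_eq]

include hdeg hsep in
/-- `disc(f) ≠ 0` for a separable quartic. -/
theorem discr_ne_zero : f.discr ≠ 0 := by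
  intro h0
  have h := sq_prod_intRoot_sub hdeg (rt_injective hdeg hsep) (aeval_rt hdeg hsep)
  rw [h0, Int.cast_zero, mul_zero, sq_eq_zero_iff] at h
  have ha : (f.leadingCoeff : Qbar) ≠ 0 := by
    rw [Int.cast_ne_zero, Ne, leadingCoeff_eq_zero]; rintro rfl; simp at hdeg
  rw [ZeroMemClass.coe_eq_zero] at h
  obtain ⟨i, -, hi⟩ := Finset.prod_eq_zero_iff.1 h
  obtain ⟨j, hj, hij⟩ := Finset.prod_eq_zero_iff.1 hi
  rw [sub_eq_zero] at hij
  have h2 := congrArg (fun x : Sbar => (x : Qbar)) hij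
  simp only [coe_intRoot] at h2
  exact (ne_of_lt (Finset.mem_Ioi.1 hj)) (rt_injective hdeg hsep (mul_left_cancel₀ ha h2))

/-- Dedekind's recipe at a good prime, for the enumerated roots and the Frobenius permutation. -/
theorem dedekind_at {p : ℕ} (hp : p.Prime) (hbad : ¬ (p : ℤ) ∣ 2 * f.leadingCoeff * f.discr)
    {𝔓 : Ideal Sbar} (h𝔓 : 𝔓 ∈ (placeOf p hp).primesAbove) {Φ : absoluteGaloisGroup ℚ}
    (hΦ : IsArithFrobAt (𝓞 ℚ) Φ 𝔓) (F : Type) [Field F] [Fintype F] {e : ℕ}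
    (hF : Fintype.card F = p ^ e) :
    (f.map (Int.castRingHom F)).roots.toFinset.card = fixCard (permFin hdeg hsep Φ ^ e) ∧
      ((∃ w : F, w ^ 2 = (f.map (Int.castRingHom F)).discr) ↔
        Equiv.Perm.sign (permFin hdeg hsep Φ ^ e) = 1) :=
  dedekind_quartic (aeval_rt hdeg hsep) hp (natCast_mem_placeOf p hp) (residueCard_placeOf p hp) h𝔓 hΦ
    (smul_rt hdeg hsep Φ) hdeg (rt_injective hdeg hsep) hbad F hF

/-- The sign recipe equals the sign of the Frobenius permutation at a good prime. -/
theorem signOf_eq {p : ℕ} (hp : p.Prime) (hbad : ¬ (p : ℤ) ∣ 2 * f.leadingCoeff * f.discr)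
    {𝔓 : Ideal Sbar} (h𝔓 : 𝔓 ∈ (placeOf p hp).primesAbove) {Φ : absoluteGaloisGroup ℚ}
    (hΦ : IsArithFrobAt (𝓞 ℚ) Φ 𝔓) : signOf f p = Equiv.Perm.sign (permFin hdeg hsep Φ) := by
  haveI : Fact p.Prime := ⟨hp⟩
  have h := (dedekind_at (hdeg := hdeg) (hsep := hsep) hp hbad h𝔓 hΦ (ZMod p) (e := 1)
    (by rw [ZMod.card, pow_one])).2
  rw [pow_one] at h
  unfold signOf
  rw [h]
  rcases Int.units_eq_one_or (Equiv.Perm.sign (permFin hdeg hsep Φ)) with h1 | h1 <;> simp [h1]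

end Assembly

end Lift

/-! ### The Galois side -/

section Main

open scoped MatrixGroups Classical
open NumberField Field IsDedekindDomain Literature.NumberTheory.GaloisRepresentations Matrix
open Literature.NumberTheory.Automorphic

/-- **The Galois side** of `ResidualAutomorphyOdd`, conditional on Tate's lifting theorem: an odd
irreducible `σ̄ : Γ_ℚ → GL₂(𝔽̄₃)` lifting `Γ_ℚ → Gal(f) ⊆ S₄ ≅ PGL₂(𝔽₃)`, a finite-order Hecke
character `ω` of `ℚ` with `ω(ϖ_p) = s(p) = ±1` the sign of the Frobenius permutation
(`= +1` iff `disc f` is a square mod `p`), the non-dihedral clause, and the table identities for the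
reduced Hecke polynomials at places of degree `1` and `2` (Dedekind's recipe). -/
theorem galoisSide (hTate : Tate_projectiveLifting) (f : ℤ[X]) (hdeg : f.natDegree = 4)
    (hsep : (f.map (Int.castRingHom ℚ)).Separable)
    (hgal : 12 ∣ Nat.card (f.map (Int.castRingHom ℚ)).Gal)
    (hreal : (f.map (Int.castRingHom ℝ)).roots.card ≠ 4) :
    ∃ (σ : FramedGaloisRep ℚ K3 2) (ω : HeckeCharacter ℚ) (s : ℕ → ℤˣ) (S : Finset ℕ),
      σ.toGaloisRep.IsIrreducible ∧ σ.IsOdd ∧ ω.IsFiniteOrder ∧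
      (∀ p (hp : p.Prime), p ∉ S → ω.valueAtUniformizer (placeOf p hp) = ((s p : ℤ) : ℂ)) ∧
      (∀ (K' : Type) [Field K'] [NumberField K'] [Algebra ℚ K'], Module.finrank ℚ K' = 2 →
        {v : HeightOneSpectrum (𝓞 ℚ) | quadraticSign K' v = -1 ∧ σ.IsUnramifiedAt v ∧
          ∃ 𝔓 ∈ v.primesAbove, ∃ Φ : absoluteGaloisGroup ℚ,
            IsArithFrobAt (𝓞 ℚ) Φ 𝔓 ∧
              Matrix.trace ((σ Φ : GL (Fin 2) K3) : Matrix (Fin 2) (Fin 2) K3) ≠ 0}.Infinite) ∧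
      (∀ p (hp : p.Prime), p ∉ S → ∀ 𝔓 ∈ (placeOf p hp).primesAbove, ∀ Φ : absoluteGaloisGroup ℚ,
        IsArithFrobAt (𝓞 ℚ) Φ 𝔓 → ∀ (F : Type) [CommRing F] [IsDomain F] [Fintype F],
          (Fintype.card F = p →
            redPoly₁ (Matrix.trace ((σ Φ : GL (Fin 2) K3) : Matrix (Fin 2) (Fin 2) K3))
              (Matrix.det ((σ Φ : GL (Fin 2) K3) : Matrix (Fin 2) (Fin 2) K3)) ((s p : ℤ) : K3) =
            (tablePoly F f).map (Int.castRingHom K3)) ∧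
          (Fintype.card F = p ^ 2 →
            redPoly₂ (Matrix.trace ((σ Φ : GL (Fin 2) K3) : Matrix (Fin 2) (Fin 2) K3))
              (Matrix.det ((σ Φ : GL (Fin 2) K3) : Matrix (Fin 2) (Fin 2) K3)) =
            (tablePoly F f).map (Int.castRingHom K3))) := by
  obtain ⟨σ, hσ⟩ := hTate 2 K3 (rhoTilde hdeg hsep) (isOpen_ker_rhoTilde hdeg hsep)
  -- the sign subgroup and its Hecke character
  set Hs : Subgroup (absoluteGaloisGroup ℚ) := (Equiv.Perm.sign.comp (permFin hdeg hsep)).ker with hHs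
  have hmemHs : ∀ γ, γ ∈ Hs ↔ Equiv.Perm.sign (permFin hdeg hsep γ) = 1 := fun γ => by
    rw [hHs, MonoidHom.mem_ker, MonoidHom.comp_apply]
  have hHo : IsOpen (Hs : Set (absoluteGaloisGroup ℚ)) := by
    apply Subgroup.isOpen_mono (H₁ := (permFin hdeg hsep).ker) ?_ (isOpen_ker_permFin hdeg hsep)
    intro γ hγ
    rw [MonoidHom.mem_ker] at hγ
    rw [hmemHs, hγ, map_one]
  have hidx : Hs.index = 1 ∨ Hs.index = 2 := by
    rw [hHs, Subgroup.index_ker]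
    have hle : Nat.card (Equiv.Perm.sign.comp (permFin hdeg hsep)).range ∣ 2 := by
      have h := Subgroup.card_subgroup_dvd_card (Equiv.Perm.sign.comp (permFin hdeg hsep)).range
      rwa [Nat.card_eq_fintype_card (α := ℤˣ), Fintype.card_units_int] at h
    exact (Nat.dvd_prime Nat.prime_two).1 hle
  obtain ⟨ω, hfin, hω⟩ := exists_heckeCharacter_of_index_le_two Hs hHo hidx
  -- the finite set of bad primes
  rw [Filter.eventually_cofinite] at hω
  set S₁ : Finset ℕ := hω.toFinset.image
    (fun v => ((Rat.HeightOneSpectrum.primesEquiv v : Nat.Primes) : ℕ)) with hS₁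
  set n₀ : ℕ := (2 * f.leadingCoeff * f.discr).natAbs with hn₀
  have hf0 : f ≠ 0 := by rintro rfl; simp at hdeg
  have hn₀0 : n₀ ≠ 0 := by
    rw [hn₀, Ne, Int.natAbs_eq_zero]
    exact mul_ne_zero (mul_ne_zero two_ne_zero (leadingCoeff_ne_zero.2 hf0)) (discr_ne_zero (hdeg := hdeg) (hsep := hsep))
  set S : Finset ℕ := S₁ ∪ n₀.primeFactors with hSdef
  have hgoodω : ∀ p (hp : p.Prime), p ∉ S → ∀ 𝔓 ∈ (placeOf p hp).primesAbove,
      ∀ Φ : absoluteGaloisGroup ℚ, IsArithFrobAt (𝓞 ℚ) Φ 𝔓 →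
        ω.valueAtUniformizer (placeOf p hp) = @ite ℂ (Φ ∈ Hs) (Classical.propDecidable _) 1 (-1) := by
    intro p hp hpS
    have hv : placeOf p hp ∉ hω.toFinset := fun h =>
      hpS (Finset.mem_union_left _ (Finset.mem_image.2 ⟨_, h, primesEquiv_placeOf p hp⟩))
    rw [Set.Finite.mem_toFinset, Set.mem_setOf_eq, not_not] at hv
    exact hv
  have hgoodp : ∀ p, p.Prime → p ∉ S → ¬ (p : ℤ) ∣ 2 * f.leadingCoeff * f.discr := by
    intro p hp hpS hdvd
    apply hpS
    apply Finset.mem_union_right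
    rw [Nat.mem_primeFactors]
    exact ⟨hp, Int.natCast_dvd.1 hdvd, hn₀0⟩
  refine ⟨σ, ω, signOf f, S, isIrreducible_of_lift hσ hgal, isOdd_of_lift hσ hreal, hfin, ?_,
    fun K' _ _ _ hK' => nonDihedral_of_lift hσ hgal K' hK', ?_⟩
  · -- `ω(ϖ_p) = s(p)`
    intro p hp hpS
    obtain ⟨𝔓, h𝔓⟩ := HeightOneSpectrum.primesAbove_nonempty (placeOf p hp)
    obtain ⟨Φ, hΦ⟩ := HeightOneSpectrum.exists_isArithFrobAt_of_mem_primesAbove_holds h𝔓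
    rw [hgoodω p hp hpS 𝔓 h𝔓 Φ hΦ, signOf_eq (hdeg := hdeg) (hsep := hsep) hp (hgoodp p hp hpS) h𝔓 hΦ]
    by_cases hΦs : Φ ∈ Hs
    · rw [if_pos hΦs, (hmemHs Φ).1 hΦs]; simp
    · rw [if_neg hΦs, (Int.units_eq_one_or _).resolve_left (fun h => hΦs ((hmemHs Φ).2 h))]; simp
  · -- the table identities
    intro p hp hpS 𝔓 h𝔓 Φ hΦ F _ _ _
    letI : Field F := Fintype.fieldOfDomain F
    obtain ⟨g, c, hc, hperm, hshape⟩ := exists_lift_entries hσ Φ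
    obtain ⟨htr, hdet⟩ := trace_det_of_lift hshape
    have htab := table_poly (L := K3) g hc
    rw [hperm] at htab
    constructor
    · intro hF
      have hFd := dedekind_at (hdeg := hdeg) (hsep := hsep) hp (hgoodp p hp hpS) h𝔓 hΦ F (e := 1) (by rw [hF, pow_one])
      rw [pow_one] at hFd
      rw [htr, hdet, signOf_eq (hdeg := hdeg) (hsep := hsep) hp (hgoodp p hp hpS) h𝔓 hΦ, htab.1,
        tablePoly_eq_cycleTable F f _ hFd.1 hFd.2]
    · intro hF
      have hFd := dedekind_at (hdeg := hdeg) (hsep := hsep) hp (hgoodp p hp hpS) h𝔓 hΦ F (e := 2) hF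
      have hsq : Equiv.Perm.sign (permFin hdeg hsep Φ ^ 2) = 1 := by rw [map_pow, Int.units_sq]
      rw [htr, hdet, htab.2, tablePoly_eq_cycleTable F f _ hFd.1 hFd.2, hsq]
      simp

end Main

end Summit.Langlands.Langlands.Theorems.ResidualAutomorphyOdd
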